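import Summits.ValiantsHypothesis.ValiantsHypothesis.Theorems.BarrierLeverSuccinctHittingSetsForVPKRSTEdgeTransversal

/-!
# Crux `BarrierLever.SuccinctHittingSetsForVP` (stmt-ValiantsHypothesis-14610) — THE DIMENSION EDGE,
# part 2: KRST's generator (KI generator of `Perm_[p]` over the Reed–Solomon design) is NOT per-seed
# `SmallCircuits ℂ n b`-succinct once `p ≥ (n+4)^(5b+23)` (unconditional; no hardness hypothesis)

Lean text authored by the cell planner seat `valiant-natproofs-p2` (gen 2b, HOME/Sketch-p2g2b.lean
§3–§4), landed by the prover seat as a helper of the crux (mirrors replaced by imports; see part 1,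
`…KRSTEdgeTransversal.lean`). Unconditional; does NOT close the item.

* `krstGen` — KRST's generator in the door's shape (`designGenerator (perPad F hmp) (krstDesign p n ·)`);
  `krstGen_transversal` — it has a transversal of size `min(p, 2^n)`: pin the permanent entry with
  design abscissa `2` to the variable named by its ordinate (`permanent_eq_of_pinned`, `bind₁_perPoly`,
  `absc_two`), and `gval_binMono_two`: `g_{μ_w}(2) = w` for the 0/1 exponent vector `μ_w` of `w < 2^n`.
* `krst_not_idealSuccinct`, `krst_not_succinctIn` (the body of the prover's `KRSTSuccinctIn` at field
  size `p`, block `m`), `krst_not_idealSuccinct_eventually` — THE EDGE: for every `b` there is `n₀`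
  such that for all `n ≥ n₀`, all primes `p ≥ (n+4)^(5b+23)` and all `2 ≤ m`, `m² ≤ p`, KRST's
  generator is not ideal-succinct for `SmallCircuits ℂ n b`. With KRST's parameters (`m = n^{3c}`,
  `p` the least prime `≥ m² + n + 1 ≥ n^{6c}`) this refutes the hypothesis `KRSTSuccinctInVP ℂ c b`
  of `Literature/Barriers/ValiantsHypothesis/AlgebraicNaturalProofsKRST.lean` for every
  `6c ≥ 5b + 24` (planner file §5; that named corollary is added once the Literature file is in the
  tree) — the per-seed succinctness door of the crux survives only in the band `b > (6c − 24)/5`.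

WHAT THIS IS NOT: not a lower bound (pure dimension count: the generator's image has dimension
≥ its transversal size); one generator / one design; Raz's constants.

References: [KumarRamyaSaptharishiTengse2022] §3.3–3.4 (the generator); [ForbesShpilkaVolk2018]
Def. 7.
-/

-- layout Summits/ValiantsHypothesis/ValiantsHypothesis forces the duplicated namespace component
set_option linter.dupNamespace false

noncomputable section

namespace Summit.ValiantsHypothesis.ValiantsHypothesis.Theorems.BarrierLever.SuccinctHittingSetsForVP

namespace KRSTEdge

open Literature.Barriers.ValiantsHypothesis Literature.Computability.AlgebraicComplexity
  Literature.Computability.MetaComplexity MvPolynomial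
open Summit.ValiantsHypothesis.ValiantsHypothesis.Theorems.BarrierLever.SuccinctHittingSetsForVP

/-! ### 3. KRST's generator: the pinned permanent and the binary transversal -/

section Pinned

variable {R : Type*} [CommSemiring R] {α : Type*} [Fintype α] [DecidableEq α]

/-- A matrix with exactly one nonzero entry per row along a permutation pattern `j = π i`, those entries
`1` except the one in row `i₀`, which is `x`, has permanent `x`. -/
theorem permanent_eq_of_pinned (π : Equiv.Perm α) (i₀ : α) (x : R) (A : Matrix α α R)
    (hA : ∀ i j, A i j = if π i = j then (if i = i₀ then x else 1) else 0) : A.permanent = x := by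
  have hAeq : A = (Matrix.diagonal (Function.update (fun _ => (1 : R)) (π i₀) x)).submatrix π id := by
    ext i j
    rw [hA, Matrix.submatrix_apply, Matrix.diagonal_apply, id]
    by_cases h : π i = j
    · rw [if_pos h, if_pos h]
      by_cases hi : i = i₀
      · subst hi; rw [if_pos rfl, h, Function.update_self]
      · have hne : π i ≠ π i₀ := fun heq => hi (π.injective heq)
        rw [if_neg hi, Function.update_of_ne hne]
    · rw [if_neg h, if_neg h]
  rw [hAeq, Matrix.permanent_permute_cols, Matrix.permanent_diagonal,
    Finset.prod_update_of_mem (Finset.mem_univ _)]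
  simp

/-- The generic permanent under a substitution of its entries. -/
theorem bind₁_perPoly {m : ℕ} {κ : Type*} (φ : Fin m × Fin m → MvPolynomial κ R) :
    bind₁ φ (perPoly (Fin m) R) = (Matrix.of fun i j => φ (i, j)).permanent := by
  change aeval φ (perPoly (Fin m) R) = _
  rw [aeval_def, eval₂_eq_eval_map, map_perPoly, eval_perPoly]

end Pinned

section KRST

variable {p : ℕ} [Fact p.Prime]

/-- The abscissa enumeration `Fin p ↪ 𝔽_p` used by `krstDesign`. -/
def absc (p : ℕ) [Fact p.Prime] : Fin p ↪ ZMod p := (ZMod.finEquiv p).toEquiv.toEmbedding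

/-- The `k`-th point of the Reed–Solomon block of `μ`: `(a_k, g_μ(a_k))`.
[cite: KumarRamyaSaptharishiTengse2022, §3.3] -/
theorem krstDesign_apply (n : ℕ) (μ : degLEMonomials n) (k : Fin p) :
    krstDesign p n μ k = (absc p k, (Polynomial.ofFn (n + 1) (expCoeffs p n μ)).eval (absc p k)) := rfl

/-- `absc ⟨2, _⟩ = 2`. -/
theorem absc_two (h2 : 2 < p) : absc p ⟨2, h2⟩ = (2 : ZMod p) := by
  obtain ⟨k, hk⟩ : ∃ k, p = k + 1 := ⟨p - 1, (Nat.succ_pred_eq_of_pos (lt_trans two_pos h2)).symm⟩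
  subst hk
  apply ZMod.val_injective
  rw [ZMod.val_ofNat_of_lt h2]
  rfl

/-- `g_μ(x) = ∑_{i<n} μ_i x^i` (the last coefficient of `expCoeffs` is `0`). -/
theorem eval_ofFn_expCoeffs (n : ℕ) (μ : degLEMonomials n) (x : ZMod p) :
    (Polynomial.ofFn (n + 1) (expCoeffs p n μ)).eval x =
      ∑ i : Fin n, (((μ : Fin n →₀ ℕ) i : ℕ) : ZMod p) * x ^ (i : ℕ) := by
  rw [eval_ofFn_eq_sum, Fin.sum_univ_castSucc]
  have hlast : expCoeffs p n μ (Fin.last n) = 0 := by simp [expCoeffs]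
  rw [hlast, zero_mul, add_zero]
  refine Finset.sum_congr rfl fun i _ => ?_
  have : expCoeffs p n μ i.castSucc = (((μ : Fin n →₀ ℕ) i : ℕ) : ZMod p) := by
    simp [expCoeffs, i.isLt]
  rw [this, Fin.val_castSucc]

/-- The 0/1 exponent vector of the binary digits of `w` below `n`. -/
def binVec (n w : ℕ) : Fin n →₀ ℕ :=
  Finsupp.equivFunOnFinite.symm fun i => if (i : ℕ) ∈ w.bitIndices then 1 else 0

/-- The entries of `binVec`. -/
@[simp] theorem binVec_apply (n w : ℕ) (i : Fin n) :
    binVec n w i = if (i : ℕ) ∈ w.bitIndices then 1 else 0 := rfl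

/-- `binVec n w` has degree `≤ n`. -/
theorem degree_binVec_le (n w : ℕ) : (binVec n w).degree ≤ n := by
  classical
  rw [Finsupp.degree_eq_sum]
  calc ∑ i, binVec n w i ≤ ∑ _i : Fin n, 1 := Finset.sum_le_sum fun i _ => by
          rw [binVec_apply]; split_ifs <;> simp
    _ = n := by simp

/-- The monomial `x^{μ_w}`, `μ_w` = bits of `w`, is a coordinate of the regime `d = n`. -/
def binMono (n w : ℕ) : degLEMonomials n := ⟨binVec n w, degree_binVec_le n w⟩

/-- `∑_{i<n} bit_i(w) 2^i = w` for `w < 2^n`. -/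
theorem sum_binVec_two_pow {n w : ℕ} (hw : w < 2 ^ n) :
    ∑ i : Fin n, binVec n w i * 2 ^ (i : ℕ) = w := by
  classical
  have h1 : ∑ i : Fin n, binVec n w i * 2 ^ (i : ℕ) =
      ∑ i ∈ Finset.range n, (if i ∈ w.bitIndices then 1 else 0) * 2 ^ i := by
    simp only [binVec_apply]
    exact Fin.sum_univ_eq_sum_range (fun i => (if i ∈ w.bitIndices then 1 else 0) * 2 ^ i) n
  have h2 : ∑ i ∈ Finset.range n, (if i ∈ w.bitIndices then 1 else 0) * 2 ^ i =
      ∑ i ∈ (Finset.range n).filter (· ∈ w.bitIndices), 2 ^ i := by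
    rw [Finset.sum_filter]
    refine Finset.sum_congr rfl fun i _ => ?_
    split_ifs <;> simp
  have h3 : (Finset.range n).filter (· ∈ w.bitIndices) = w.bitIndices.toFinset := by
    ext i
    simp only [Finset.mem_filter, Finset.mem_range, List.mem_toFinset]
    constructor
    · exact fun h => h.2
    · intro h
      refine ⟨?_, h⟩
      by_contra hni
      have h2i : 2 ^ n ≤ 2 ^ i := Nat.pow_le_pow_right two_pos (not_lt.mp hni)
      exact absurd (lt_of_lt_of_le hw (h2i.trans (Nat.two_pow_le_of_mem_bitIndices h))) (lt_irrefl w)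
  rw [h1, h2, h3, List.sum_toFinset _ Nat.bitIndices_nodup, Nat.sum_map_two_pow_bitIndices]

/-- `g_{μ_w}(2) = w` in `𝔽_p` for `w < 2^n`. -/
theorem gval_binMono_two {n w : ℕ} (hw : w < 2 ^ n) :
    (Polynomial.ofFn (n + 1) (expCoeffs p n (binMono n w))).eval (2 : ZMod p) = (w : ZMod p) := by
  rw [eval_ofFn_expCoeffs, ← congrArg (Nat.cast : ℕ → ZMod p) (sum_binVec_two_pow hw)]
  push_cast
  rfl

variable (F : Type*) [CommSemiring F]

/-- **KRST's generator has a transversal indexed by the ordinates at abscissa `2`.** There is ONE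
substitution `H` of the `p²` seed variables (entry with design abscissa `2` ↦ the variable named by its
ordinate; the other entries of a permutation pattern through it ↦ `1`; everything else ↦ `0`) under which
output `μ` becomes the variable `X (g_μ(2))`. Requires `2 ≤ m` (so that position `2 < m²` exists). -/
theorem krstGen_transversal {n m : ℕ} (hm : 2 ≤ m) (hmp : m * m ≤ p) :
    ∃ H : ZMod p × ZMod p → MvPolynomial (ZMod p) F, ∀ μ : degLEMonomials n,
      bind₁ H (krstGen F p n hmp μ) =
        X ((Polynomial.ofFn (n + 1) (expCoeffs p n μ)).eval (2 : ZMod p)) := by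
  classical
  have h2mm : 2 < m * m := lt_of_lt_of_le (by norm_num) (Nat.mul_le_mul hm hm)
  have h2p : 2 < p := lt_of_lt_of_le h2mm hmp
  -- the pinned position `(i₀, j₀)`: the matrix entry whose padded index is `2`
  set ij : Fin m × Fin m := finProdFinEquiv.symm ⟨2, h2mm⟩ with hij
  have hpad : permPad hmp ij = ⟨2, h2p⟩ := by
    apply Fin.ext
    show ((Fin.castLEEmb hmp) (finProdFinEquiv (finProdFinEquiv.symm ⟨2, h2mm⟩))).val = 2
    rw [Equiv.apply_symm_apply]; rfl
  set π : Equiv.Perm (Fin m) := Equiv.swap ij.1 ij.2 with hπ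
  have hπ0 : π ij.1 = ij.2 := Equiv.swap_apply_left _ _
  -- abscissa of matrix entry `(i, j)`
  let ab : Fin m × Fin m → ZMod p := fun q => absc p (permPad hmp q)
  have hab_inj : Function.Injective ab := fun q q' h => (permPad hmp).injective ((absc p).injective h)
  have hab0 : ab ij = 2 := by simp only [ab, hpad, absc_two h2p]
  -- the substitution
  let T : Finset (ZMod p) := (Finset.univ.filter fun i : Fin m => i ≠ ij.1).image fun i => ab (i, π i)
  let H : ZMod p × ZMod p → MvPolynomial (ZMod p) F :=
    fun xw => if xw.1 = 2 then X xw.2 else if xw.1 ∈ T then 1 else 0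
  refine ⟨H, fun μ => ?_⟩
  set g := Polynomial.ofFn (n + 1) (expCoeffs p n μ) with hg
  -- unfold the generator: `bind₁ H (rename S_μ (rename permPad per_m)) = per (H ∘ S_μ ∘ permPad)`
  have hgen : bind₁ H (krstGen F p n hmp μ) =
      (Matrix.of fun i j => H (krstDesign p n μ (permPad hmp (i, j)))).permanent := by
    show bind₁ H (rename (⇑(krstDesign p n μ)) (rename (permPad hmp) (perPoly (Fin m) F))) = _
    rw [bind₁_rename, bind₁_rename, bind₁_perPoly]
    rfl
  rw [hgen]
  apply permanent_eq_of_pinned π ij.1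
  intro i j
  rw [Matrix.of_apply, krstDesign_apply]
  -- entry `(i, j)` has abscissa `ab (i, j)` and ordinate `g (ab (i, j))`
  change (if ab (i, j) = 2 then X (g.eval (ab (i, j))) else if ab (i, j) ∈ T then 1 else 0) = _
  have hmemT : ab (i, j) ∈ T ↔ π i = j ∧ i ≠ ij.1 := by
    constructor
    · intro hT
      obtain ⟨i', hi', heq⟩ := Finset.mem_image.mp hT
      have hq : (i', π i') = (i, j) := hab_inj heq
      injection hq with hq1 hq2
      subst hq1
      exact ⟨hq2, (Finset.mem_filter.mp hi').2⟩
    · rintro ⟨rfl, hi⟩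
      exact Finset.mem_image.mpr ⟨i, Finset.mem_filter.mpr ⟨Finset.mem_univ _, hi⟩, rfl⟩
  have heq2 : ab (i, j) = 2 ↔ (i, j) = ij := by
    rw [← hab0]; exact hab_inj.eq_iff
  by_cases hij' : (i, j) = ij
  · -- the pinned entry
    have hi : i = ij.1 := (congrArg Prod.fst hij' : _)
    have hj : j = ij.2 := (congrArg Prod.snd hij' : _)
    rw [if_pos (heq2.mpr hij'), (heq2.mpr hij' : ab (i, j) = 2), if_pos (by rw [hi, hπ0, hj]), if_pos hi]
  · rw [if_neg (fun h => hij' (heq2.mp h))]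
    by_cases hπi : π i = j
    · have hi : i ≠ ij.1 := by
        rintro rfl; apply hij'; rw [← hπi, hπ0]
      rw [if_pos (hmemT.mpr ⟨hπi, hi⟩), if_pos hπi, if_neg hi]
    · rw [if_neg (fun h => hπi (hmemT.mp h).1), if_neg hπi]

end KRST

/-! ### 4. The dimension edge for KRST's generator -/

section Edge

/-- **KRST's generator is not ideal-succinct for `SmallCircuits ℂ n b` outside the window.** If
`2 ≤ m`, `m² ≤ p`, and some `k ≤ min(p, 2^n)` has `2^k > (k·2n+1)^(9376 (n+4)^(5b+21))`, then some equation of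
`coeff(SmallCircuits ℂ n b)` does not annihilate the generator. No hardness hypothesis. -/
theorem krst_not_idealSuccinct {p n m b k : ℕ} [Fact p.Prime] (hm : 2 ≤ m) (hmp : m * m ≤ p)
    (hn : 1 ≤ n) (hkp : k ≤ p) (hkn : k ≤ 2 ^ n)
    (hcard : (k * (2 * n) + 1) ^ (9376 * (n + 4) ^ (5 * b + 21)) < 2 ^ k) :
    ¬ IsIdealSuccinctGenerator (degLEMonomials n) (SmallCircuits ℂ n b) (krstGen ℂ p n hmp) := by
  intro hsucc
  obtain ⟨H, hH⟩ := krstGen_transversal ℂ hm hmp (n := n)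
  let E : Fin k → degLEMonomials n := fun w => binMono n w
  let ν : Fin k → ZMod p := fun w => ((w : ℕ) : ZMod p)
  have hE : ∀ w : Fin k, bind₁ H (krstGen ℂ p n hmp (E w)) = X (ν w) := fun w => by
    rw [hH, gval_binMono_two (lt_of_lt_of_le w.isLt hkn)]
  have hν : Function.Injective ν := by
    intro w w' h
    have h' := (ZMod.natCast_eq_natCast_iff' _ _ _).mp h
    rw [Nat.mod_eq_of_lt (lt_of_lt_of_le w.isLt hkp),
      Nat.mod_eq_of_lt (lt_of_lt_of_le w'.isLt hkp)] at h'
    exact Fin.ext h'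
  have := two_pow_le_of_transversal hn hsucc hE hν
  rw [Fintype.card_fin] at this
  exact absurd hcard (not_lt.mpr this)

/-- Per-seed form, literally the prover's `KRSTSuccinctIn (fun n => SmallCircuits ℂ n b)` at field size `p`
and block `m` (FullScratch L2230, with `p = krstPrime c n`, `m = n^(3c)`): it FAILS under the hypotheses of
`krst_not_idealSuccinct`. -/
theorem krst_not_succinctIn {p n m b k : ℕ} [Fact p.Prime] (hm : 2 ≤ m) (hmp : m * m ≤ p)
    (hn : 1 ≤ n) (hkp : k ≤ p) (hkn : k ≤ 2 ^ n)
    (hcard : (k * (2 * n) + 1) ^ (9376 * (n + 4) ^ (5 * b + 21)) < 2 ^ k) :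
    ¬ (∀ y : ZMod p × ZMod p → ℂ, ∃ g ∈ SmallCircuits ℂ n b, ∀ μ : degLEMonomials n,
        coeff (μ : Fin n →₀ ℕ) g = eval (y ∘ krstDesign p n μ) (perPad ℂ hmp)) := by
  intro h
  refine krst_not_idealSuccinct hm hmp hn hkp hkn hcard (IsSuccinctGenerator.ideal fun y => ?_)
  obtain ⟨g, hg, hcoeff⟩ := h y
  refine ⟨g, hg, funext fun μ => ?_⟩
  rw [coeffVector_apply, hcoeff μ, genOutput, krstGen, designGenerator, eval_rename]

/-- `(n+4)^j ≤ n^(j+1)` once `n ≥ max(4, 2^j)`. -/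
theorem add_four_pow_le (j n : ℕ) (h4 : 4 ≤ n) (h2 : 2 ^ j ≤ n) : (n + 4) ^ j ≤ n ^ (j + 1) := by
  calc (n + 4) ^ j ≤ (2 * n) ^ j := Nat.pow_le_pow_left (by omega) _
    _ = 2 ^ j * n ^ j := mul_pow 2 n j
    _ ≤ n * n ^ j := Nat.mul_le_mul_right _ h2
    _ = n ^ (j + 1) := by rw [pow_succ']

/-- **The dimension edge, eventual form.** For every `b` there is `n₀` such that for all `n ≥ n₀`, every
prime `p ≥ (n+4)^(5b+23)` and every `2 ≤ m`, `m² ≤ p`: KRST's generator is not ideal-succinct (a fortiori not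
per-seed succinct) for `SmallCircuits ℂ n b`. (No upper bound on `p` is needed: the transversal has size
`min(p, 2^n) ≥ (n+4)^(5b+23)`.) -/
theorem krst_not_idealSuccinct_eventually (b : ℕ) : ∃ n₀ : ℕ, ∀ n : ℕ, n₀ ≤ n →
    ∀ (p m : ℕ) [Fact p.Prime], 2 ≤ m → (hmp : m * m ≤ p) → (n + 4) ^ (5 * b + 23) ≤ p →
      ¬ IsIdealSuccinctGenerator (degLEMonomials n) (SmallCircuits ℂ n b) (krstGen ℂ p n hmp) := by
  obtain ⟨n₀, hn₀⟩ := threshold b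
  obtain ⟨n₁, hn₁⟩ := LowDegreeEquations.eventually_mul_pow_le_two_pow 1 (5 * b + 24)
  refine ⟨n₀ + n₁ + 4 + 2 ^ (5 * b + 23), fun n hn p m _ hm hmp hkp => ?_⟩
  have h2K : 2 ^ (5 * b + 23) ≤ n := le_trans (Nat.le_add_left _ _) hn
  have h01 : n₀ + n₁ + 4 ≤ n := le_trans (Nat.le_add_right _ _) hn
  have hkn : (n + 4) ^ (5 * b + 23) ≤ 2 ^ n :=
    (add_four_pow_le _ n (by omega) h2K).trans
      (by have h := hn₁ n (by omega); rwa [one_mul] at h)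
  exact krst_not_idealSuccinct hm hmp (by omega) hkp hkn (hn₀ n (by omega))

end Edge


end KRSTEdge

end Summit.ValiantsHypothesis.ValiantsHypothesis.Theorems.BarrierLever.SuccinctHittingSetsForVP

end
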